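import Literature.Analysis.Asymptotics.PoincareRatioTheorem
import Summits.KontsevichZagierPeriods.Zeta5Search.Zudilin2002Casoratian
import HarnessLib

/-!
# ζ(5) search — EXACT growth rates of Zudilin's `qₙ, pₙ, p̃ₙ` by Poincaré's theorem (cell `pub-zeta5`, TYPER)

HONEST FRAMING: systematic search; no irrationality claim unless certified.

Fourth part of the kernel-certified study of Zudilin's 2002 third-order recursion for `ζ(5)`
(`Literature.NumberTheory.Irrationality.Zudilin2002.{q, p, ptilde}`), after
`Zudilin2002Growth.lean` (ratio box `796 ≤ u_{n+1}/uₙ ≤ 2369` for `uₙ = (-1)^{n+1}qₙ`),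
`Zudilin2002Casoratian.lean` and `Zudilin2002Approximants.lean`. The box is an A-PRIORI BRACKET;
combined with the tree's Poincaré theorem for order-3 recurrences under a bracket
(`Literature.Analysis.Asymptotics.PoincareRecurrence.tendsto_ratio_of_recurrence₃`, Elaydi Thm 7.10)
and Elaydi's Lemma 7.14 (`tendsto_log_abs_div_of_tendsto_ratio`) it yields EXACT limits:

* `tendsto_A`, `tendsto_B`, `tendsto_C` — the coefficients of the sign-flipped recursion
  `u_{m+3} = A_m u_{m+2} + B_m u_{m+1} + C_m u_m` tend to `2368, 752, -16`: the limiting equation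
  `λ³ = 2368λ² + 752λ - 16` is Zudilin's characteristic polynomial (5) `μ³ + 2368μ² - 752μ - 16` at
  `μ = -λ`;
* `tendsto_ratio_u` — `u_{n+1}/uₙ → -μ` for every root `μ ≤ -796` of (5) (there is exactly one,
  `μ₃ = -2368.31752…`; contraction constant `752/796² + 32/796³ < 1`);
* `tendsto_log_abs_q_div` — `log|qₙ|/n → log|μ₃|`;
* the same for the other two printed solutions: `v_ratio_bounds`/`vt_ratio_bounds` (the box
  `[796, 2369]` again, same corner inequalities, initial ratios `p₃/p₂ = p̃₃/p̃₂ = -796.87…`),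
  `tendsto_log_abs_p_div`, `tendsto_log_abs_ptilde_div`;
* `growth_rates` — packaged literally as the three growth conjuncts of the tree's NAMED FACT
  `Zudilin2002.theorem1_rates` (Theorem 1, eq. (5)): these conjuncts are now THEOREMS of the tree
  (unconditional, 0 sorry). The two decay conjuncts (`log|ℓₙ|/n, log|ℓ̃ₙ|/n → log μ₂`) are the
  analytic content of Zudilin's hypergeometric construction and remain cited.
-/

noncomputable section

open Filter Topology Finset Set
open Literature.NumberTheory.Irrationality.Zudilin2002
open Literature.Analysis.Asymptotics.PoincareRecurrence

namespace Summit.KontsevichZagierPeriods.Zeta5Search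

namespace Zudilin2002Growth

/-! ### Limits of the coefficients `A_m, B_m, C_m` -/

/-- `1/(m+1) → 0` along `ℕ` (the substitution used for all coefficient limits). -/
private theorem tendsto_inv_succ : Tendsto (fun m : ℕ => (1 : ℝ) / ((m : ℝ) + 1)) atTop (𝓝 0) :=
  tendsto_one_div_add_atTop_nhds_zero_nat

/-- **`A_m → 2368`** (`A_m = a₁(m+2)/((m+3)⁶a₀(m+2))`, leading coefficients `2·48802112 = 2368·41218`). -/
theorem tendsto_A : Tendsto A atTop (𝓝 2368) := by
  -- `A m = F(y)/G(y)` with `y = 1/(m+1)`, `F, G` polynomials, `G(0) = 41218 ≠ 0`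
  set F : ℝ → ℝ := fun y => 2 * (48802112 * (1 + y) ^ 9 + 89030880 * (1 + y) ^ 8 * y +
      36002654 * (1 + y) ^ 7 * y ^ 2 - 24317344 * (1 + y) ^ 6 * y ^ 3 -
      19538418 * (1 + y) ^ 5 * y ^ 4 + 1311365 * (1 + y) ^ 4 * y ^ 5 +
      3790503 * (1 + y) ^ 3 * y ^ 6 + 460056 * (1 + y) ^ 2 * y ^ 7 - 271701 * (1 + y) * y ^ 8 -
      60291 * y ^ 9) with hF
  set G : ℝ → ℝ := fun y => (1 + 2 * y) ^ 6 * (41218 * (1 + y) ^ 3 - 48459 * (1 + y) ^ 2 * y +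
      20010 * (1 + y) * y ^ 2 - 2871 * y ^ 3) with hG
  have hGpos : ∀ m : ℕ, 0 < G (1 / ((m : ℝ) + 1)) := by
    intro m
    have hm : (m : ℝ) + 1 ≠ 0 := by positivity
    have e : G (1 / ((m : ℝ) + 1)) = L m / ((m : ℝ) + 1) ^ 9 := by
      rw [hG]; unfold L; simp only [a₀]; field_simp; ring
    rw [e]; exact div_pos (L_pos m) (by positivity)
  have hAeq : ∀ m : ℕ, A m = F (1 / ((m : ℝ) + 1)) / G (1 / ((m : ℝ) + 1)) := by
    intro m
    have hm : (m : ℝ) + 1 ≠ 0 := by positivity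
    have ha : a₀ ((m : ℝ) + 2) ≠ 0 := by rw [a₀_add_two]; positivity
    have hm3 : (m : ℝ) + 3 ≠ 0 := by positivity
    rw [eq_div_iff (hGpos m).ne']
    unfold A L
    rw [hF, hG]
    simp only
    field_simp
    simp only [a₀, a₁]
    ring
  have hFc : Continuous F := by rw [hF]; fun_prop
  have hGc : Continuous G := by rw [hG]; fun_prop
  have hF0 : Tendsto (fun m : ℕ => F (1 / ((m : ℝ) + 1))) atTop (𝓝 (F 0)) :=
    (hFc.tendsto 0).comp tendsto_inv_succ
  have hG0 : Tendsto (fun m : ℕ => G (1 / ((m : ℝ) + 1))) atTop (𝓝 (G 0)) :=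
    (hGc.tendsto 0).comp tendsto_inv_succ
  have hG0ne : G 0 ≠ 0 := by rw [hG]; norm_num
  have hlim : F 0 / G 0 = 2368 := by rw [hF, hG]; norm_num
  rw [← hlim]
  exact (hF0.div hG0 hG0ne).congr fun m => (hAeq m).symm

/-- **`B_m → 752`** (`B_m = 4(2m+3)a₂(m+2)/((m+3)⁶a₀(m+2))`, `8·3874492 = 752·41218`). -/
theorem tendsto_B : Tendsto B atTop (𝓝 752) := by
  set F : ℝ → ℝ := fun y => 4 * (2 + y) * (-44541 * y ^ 8 + 170716 * (1 + y) * y ^ 7 +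
      115771 * (1 + y) ^ 2 * y ^ 6 - 1182926 * (1 + y) ^ 3 * y ^ 5 + 647130 * (1 + y) ^ 4 * y ^ 4 +
      2947148 * (1 + y) ^ 5 * y ^ 3 - 3144314 * (1 + y) ^ 6 * y ^ 2 - 2617900 * (1 + y) ^ 7 * y +
      3874492 * (1 + y) ^ 8) with hF
  set G : ℝ → ℝ := fun y => (1 + 2 * y) ^ 6 * (41218 * (1 + y) ^ 3 - 48459 * (1 + y) ^ 2 * y +
      20010 * (1 + y) * y ^ 2 - 2871 * y ^ 3) with hG
  have hGpos : ∀ m : ℕ, 0 < G (1 / ((m : ℝ) + 1)) := by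
    intro m
    have hm : (m : ℝ) + 1 ≠ 0 := by positivity
    have e : G (1 / ((m : ℝ) + 1)) = L m / ((m : ℝ) + 1) ^ 9 := by
      rw [hG]; unfold L; simp only [a₀]; field_simp; ring
    rw [e]; exact div_pos (L_pos m) (by positivity)
  have hBeq : ∀ m : ℕ, B m = F (1 / ((m : ℝ) + 1)) / G (1 / ((m : ℝ) + 1)) := by
    intro m
    have hm : (m : ℝ) + 1 ≠ 0 := by positivity
    have ha : a₀ ((m : ℝ) + 2) ≠ 0 := by rw [a₀_add_two]; positivity
    have hm3 : (m : ℝ) + 3 ≠ 0 := by positivity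
    rw [eq_div_iff (hGpos m).ne']
    unfold B Bn L
    rw [hF, hG]
    simp only
    field_simp
    simp only [a₀, a₂]
    ring
  have hFc : Continuous F := by rw [hF]; fun_prop
  have hGc : Continuous G := by rw [hG]; fun_prop
  have hF0 : Tendsto (fun m : ℕ => F (1 / ((m : ℝ) + 1))) atTop (𝓝 (F 0)) :=
    (hFc.tendsto 0).comp tendsto_inv_succ
  have hG0 : Tendsto (fun m : ℕ => G (1 / ((m : ℝ) + 1))) atTop (𝓝 (G 0)) :=
    (hGc.tendsto 0).comp tendsto_inv_succ
  have hG0ne : G 0 ≠ 0 := by rw [hG]; norm_num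
  have hlim : F 0 / G 0 = 752 := by rw [hF, hG]; norm_num
  rw [← hlim]
  exact (hF0.div hG0 hG0ne).congr fun m => (hBeq m).symm

/-- **`C_m → -16`** (`C_m = -4(m+1)⁴(2m+3)(2m+1)a₀(m+3)/((m+3)⁶a₀(m+2))`). -/
theorem tendsto_C : Tendsto C atTop (𝓝 (-16)) := by
  set F : ℝ → ℝ := fun y => -4 * (2 + y) * (2 - y) * (41218 * (1 + 2 * y) ^ 3 -
      48459 * (1 + 2 * y) ^ 2 * y + 20010 * (1 + 2 * y) * y ^ 2 - 2871 * y ^ 3) with hF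
  set G : ℝ → ℝ := fun y => (1 + 2 * y) ^ 6 * (41218 * (1 + y) ^ 3 - 48459 * (1 + y) ^ 2 * y +
      20010 * (1 + y) * y ^ 2 - 2871 * y ^ 3) with hG
  have hGpos : ∀ m : ℕ, 0 < G (1 / ((m : ℝ) + 1)) := by
    intro m
    have hm : (m : ℝ) + 1 ≠ 0 := by positivity
    have e : G (1 / ((m : ℝ) + 1)) = L m / ((m : ℝ) + 1) ^ 9 := by
      rw [hG]; unfold L; simp only [a₀]; field_simp; ring
    rw [e]; exact div_pos (L_pos m) (by positivity)
  have hCeq : ∀ m : ℕ, C m = F (1 / ((m : ℝ) + 1)) / G (1 / ((m : ℝ) + 1)) := by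
    intro m
    have hm : (m : ℝ) + 1 ≠ 0 := by positivity
    have ha : a₀ ((m : ℝ) + 2) ≠ 0 := by rw [a₀_add_two]; positivity
    have hm3 : (m : ℝ) + 3 ≠ 0 := by positivity
    rw [eq_div_iff (hGpos m).ne']
    unfold C Cn L
    rw [hF, hG]
    simp only
    field_simp
    simp only [a₀]
    ring
  have hFc : Continuous F := by rw [hF]; fun_prop
  have hGc : Continuous G := by rw [hG]; fun_prop
  have hF0 : Tendsto (fun m : ℕ => F (1 / ((m : ℝ) + 1))) atTop (𝓝 (F 0)) :=
    (hFc.tendsto 0).comp tendsto_inv_succ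
  have hG0 : Tendsto (fun m : ℕ => G (1 / ((m : ℝ) + 1))) atTop (𝓝 (G 0)) :=
    (hGc.tendsto 0).comp tendsto_inv_succ
  have hG0ne : G 0 ≠ 0 := by rw [hG]; norm_num
  have hlim : F 0 / G 0 = -16 := by rw [hF, hG]; norm_num
  rw [← hlim]
  exact (hF0.div hG0 hG0ne).congr fun m => (hCeq m).symm

/-! ### Poincaré: the ratio limit for any solution bracketed in `[796, 2369]` -/

/-- A root `μ` of Zudilin's characteristic polynomial (5) gives a root `λ = -μ` of the limiting
equation `λ³ = 2368λ² + 752λ - 16` of the sign-flipped recursion. -/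
theorem neg_root_of_charPoly {μ : ℝ} (h : charPoly μ = 0) :
    (-μ) ^ 3 = 2368 * (-μ) ^ 2 + 752 * (-μ) + (-16) := by
  unfold charPoly at h
  linear_combination -h

/-- **Poincaré's theorem applied**: any real solution `w` of the sign-flipped recursion with
`w_n > 0` and `796 w_n ≤ w_{n+1}` for `n ≥ 2` has `w_{n+1}/w_n → -μ` for every root `μ ≤ -796` of (5)
(contraction constant `752/796² + 2·16/796³ < 1`). -/
theorem tendsto_ratio_of_bracket (w : ℕ → ℝ)
    (hrec : ∀ m, w (m + 3) = A m * w (m + 2) + B m * w (m + 1) + C m * w m)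
    (hbr : ∀ n, 2 ≤ n → 0 < w n ∧ 796 * w n ≤ w (n + 1))
    {μ : ℝ} (hμ : charPoly μ = 0) (hle : μ ≤ -796) :
    Tendsto (fun n => w (n + 1) / w n) atTop (𝓝 (-μ)) := by
  refine tendsto_ratio_of_recurrence₃ w A B C (L := 796) 2 (fun m _ => hrec m) tendsto_A tendsto_B
    tendsto_C (by norm_num) (fun n hn => (hbr n hn).1.ne') (fun n hn => ?_) (neg_root_of_charPoly hμ)
    (by linarith) (by norm_num)
  obtain ⟨hpos, hle'⟩ := hbr n hn
  rwa [le_div_iff₀ hpos]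

/-- **Rate from ratio** for such a solution: `log|w_n|/n → log|μ|`. -/
theorem tendsto_log_abs_div_of_bracket (w : ℕ → ℝ)
    (hrec : ∀ m, w (m + 3) = A m * w (m + 2) + B m * w (m + 1) + C m * w m)
    (hbr : ∀ n, 2 ≤ n → 0 < w n ∧ 796 * w n ≤ w (n + 1))
    {μ : ℝ} (hμ : charPoly μ = 0) (hle : μ ≤ -796) :
    Tendsto (fun n => Real.log |w n| / n) atTop (𝓝 (Real.log |μ|)) := by
  have h := tendsto_log_abs_div_of_tendsto_ratio w 2 (fun n hn => (hbr n hn).1.ne')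
    (show -μ ≠ 0 by linarith) (tendsto_ratio_of_bracket w hrec hbr hμ hle)
  rwa [abs_neg] at h

/-! ### `qₙ` -/

/-- **Exact ratio limit for `qₙ`**: `u_{n+1}/uₙ = -q_{n+1}/qₙ → -μ` for every root `μ ≤ -796` of (5). -/
theorem tendsto_ratio_u {μ : ℝ} (hμ : charPoly μ = 0) (hle : μ ≤ -796) :
    Tendsto (fun n => u (n + 1) / u n) atTop (𝓝 (-μ)) :=
  tendsto_ratio_of_bracket u u_rec (fun n hn => ⟨(ratio_bounds n hn).1, (ratio_bounds n hn).2.1⟩) hμ hle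

/-- **Exact growth rate of `qₙ`**: `log|qₙ|/n → log|μ|` for every root `μ ≤ -796` of (5)
(Zudilin's `log|μ₃| = 7.769935…`). -/
theorem tendsto_log_abs_q_div {μ : ℝ} (hμ : charPoly μ = 0) (hle : μ ≤ -796) :
    Tendsto (fun n : ℕ => Real.log |(q n : ℝ)| / n) atTop (𝓝 (Real.log |μ|)) := by
  have h := tendsto_log_abs_div_of_bracket u u_rec
    (fun n hn => ⟨(ratio_bounds n hn).1, (ratio_bounds n hn).2.1⟩) hμ hle
  refine h.congr fun n => ?_
  unfold u
  rw [abs_mul, abs_pow, abs_neg, abs_one, one_pow, one_mul]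

/-! ### `pₙ`: the same box `[796, 2369]` -/

/-- `v₂ = 1190161/64`. -/
theorem v_two : v 2 = 1190161 / 64 := by
  unfold v; rw [p_two]; norm_num

/-- `v₃ = 38410106195/2592`. -/
theorem v_three : v 3 = 38410106195 / 2592 := by
  unfold v; rw [p_three]; norm_num

/-- `v₄ = 873032613281675/55296`. -/
theorem v_four : v 4 = 873032613281675 / 55296 := by
  unfold v; rw [p_four]; norm_num

/-- **Kernel-certified ratio bracket for `pₙ`**: for `n ≥ 2`, `vₙ = (-1)^{n+1}pₙ > 0` and
`796 vₙ ≤ v_{n+1} ≤ 2369 vₙ` (corner inequalities of `Zudilin2002Growth`, initial ratios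
`p₃/p₂ = -796.87…`, `p₄/p₃ = -1065.4…`). -/
theorem v_ratio_bounds : ∀ n, 2 ≤ n → 0 < v n ∧ 796 * v n ≤ v (n + 1) ∧ v (n + 1) ≤ 2369 * v n := by
  refine ratio_bounds_of_recurrence3_mixed v A B C 2 (fun m _ => v_rec m) (by norm_num)
    (fun m _ => C_nonpos m) (fun m hm => corner_bc m hm) (fun m hm => corner_low m hm)
    (fun m hm => corner_up m hm) ?_ ?_ ?_ ?_ ?_
  · rw [v_two]; norm_num
  · rw [v_two, v_three]; norm_num
  · rw [v_two, v_three]; norm_num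
  · rw [v_three, v_four]; norm_num
  · rw [v_three, v_four]; norm_num

/-- **Exact growth rate of `pₙ`**: `log|pₙ|/n → log|μ|` for every root `μ ≤ -796` of (5). -/
theorem tendsto_log_abs_p_div {μ : ℝ} (hμ : charPoly μ = 0) (hle : μ ≤ -796) :
    Tendsto (fun n : ℕ => Real.log |(p n : ℝ)| / n) atTop (𝓝 (Real.log |μ|)) := by
  have h := tendsto_log_abs_div_of_bracket v v_rec
    (fun n hn => ⟨(v_ratio_bounds n hn).1, (v_ratio_bounds n hn).2.1⟩) hμ hle
  refine h.congr fun n => ?_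
  unfold v
  rw [abs_mul, abs_pow, abs_neg, abs_one, one_pow, one_mul]

/-! ### `p̃ₙ`: the same box `[796, 2369]` -/

/-- `ṽₙ = (-1)^{n+1} p̃ₙ` (real-valued): the sign-normalised `ζ(3)`-numerators. -/
def vt (n : ℕ) : ℝ := (-1) ^ (n + 1) * (ptilde n : ℝ)

/-- **The sign-flipped recursion for `ṽ`**: `ṽ_{m+3} = A_m ṽ_{m+2} + B_m ṽ_{m+1} + C_m ṽ_m`. -/
theorem vt_rec (m : ℕ) : vt (m + 3) = A m * vt (m + 2) + B m * vt (m + 1) + C m * vt m := by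
  have hL : L m ≠ 0 := (L_pos m).ne'
  have h := L_mul_sol 0 (101 / 2) (-344923 / 16) m
  unfold vt A B C ptilde
  have e3 : ((-1 : ℝ)) ^ (m + 3 + 1) = (-1) ^ m := by ring
  have e2 : ((-1 : ℝ)) ^ (m + 2 + 1) = -(-1) ^ m := by ring
  have e1 : ((-1 : ℝ)) ^ (m + 1 + 1) = (-1) ^ m := by ring
  have e0 : ((-1 : ℝ)) ^ (m + 1) = -(-1) ^ m := by ring
  rw [e3, e2, e1, e0, div_mul_eq_mul_div, div_mul_eq_mul_div, div_mul_eq_mul_div, ← add_div,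
    ← add_div, eq_div_iff hL]
  linear_combination (-1 : ℝ) ^ m * h

/-- `p̃₂ = -344923/16` (printed initial value). -/
theorem ptilde_two : ptilde 2 = -344923 / 16 := by
  unfold ptilde sol; rfl

/-- `p̃₃ = 3710571371/216`. -/
theorem ptilde_three : ptilde 3 = 3710571371 / 216 := by
  norm_num [ptilde, sol, rec3, rec3Aux, step, a₀, a₁, a₂]

/-- `p̃₄ = -21084619007795/1152`. -/
theorem ptilde_four : ptilde 4 = -21084619007795 / 1152 := by
  norm_num [ptilde, sol, rec3, rec3Aux, step, a₀, a₁, a₂]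

/-- `ṽ₂ = 344923/16`. -/
theorem vt_two : vt 2 = 344923 / 16 := by
  unfold vt; rw [ptilde_two]; norm_num

/-- `ṽ₃ = 3710571371/216`. -/
theorem vt_three : vt 3 = 3710571371 / 216 := by
  unfold vt; rw [ptilde_three]; norm_num

/-- `ṽ₄ = 21084619007795/1152`. -/
theorem vt_four : vt 4 = 21084619007795 / 1152 := by
  unfold vt; rw [ptilde_four]; norm_num

/-- **Kernel-certified ratio bracket for `p̃ₙ`**: for `n ≥ 2`, `ṽₙ = (-1)^{n+1}p̃ₙ > 0` and
`796 ṽₙ ≤ ṽ_{n+1} ≤ 2369 ṽₙ` (initial ratios `p̃₃/p̃₂ = -796.87…`, `p̃₄/p̃₃ = -1065.4…`). -/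
theorem vt_ratio_bounds :
    ∀ n, 2 ≤ n → 0 < vt n ∧ 796 * vt n ≤ vt (n + 1) ∧ vt (n + 1) ≤ 2369 * vt n := by
  refine ratio_bounds_of_recurrence3_mixed vt A B C 2 (fun m _ => vt_rec m) (by norm_num)
    (fun m _ => C_nonpos m) (fun m hm => corner_bc m hm) (fun m hm => corner_low m hm)
    (fun m hm => corner_up m hm) ?_ ?_ ?_ ?_ ?_
  · rw [vt_two]; norm_num
  · rw [vt_two, vt_three]; norm_num
  · rw [vt_two, vt_three]; norm_num
  · rw [vt_three, vt_four]; norm_num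
  · rw [vt_three, vt_four]; norm_num

/-- **Exact growth rate of `p̃ₙ`**: `log|p̃ₙ|/n → log|μ|` for every root `μ ≤ -796` of (5). -/
theorem tendsto_log_abs_ptilde_div {μ : ℝ} (hμ : charPoly μ = 0) (hle : μ ≤ -796) :
    Tendsto (fun n : ℕ => Real.log |(ptilde n : ℝ)| / n) atTop (𝓝 (Real.log |μ|)) := by
  have h := tendsto_log_abs_div_of_bracket vt vt_rec
    (fun n hn => ⟨(vt_ratio_bounds n hn).1, (vt_ratio_bounds n hn).2.1⟩) hμ hle
  refine h.congr fun n => ?_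
  unfold vt
  rw [abs_mul, abs_pow, abs_neg, abs_one, one_pow, one_mul]

/-! ### The growth half of Theorem 1, eq. (5), as a theorem -/

/-- **The root `μ₃` is unique in `(-∞, -796]`** (two roots there would be two limits of `u_{n+1}/uₙ`). -/
theorem charPoly_root_unique {μ μ' : ℝ} (hμ : charPoly μ = 0) (hle : μ ≤ -796)
    (hμ' : charPoly μ' = 0) (hle' : μ' ≤ -796) : μ = μ' := by
  have h := tendsto_nhds_unique (tendsto_ratio_u hμ hle) (tendsto_ratio_u hμ' hle')
  linarith

/-- **Zudilin 2002, Theorem 1, eq. (5) — growth conjuncts PROVED.** There is a root `μ₃` of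
`μ³ + 2368μ² - 752μ - 16` in `(-2368.31752214, -2368.31752213)` with
`log|qₙ|/n, log|pₙ|/n, log|p̃ₙ|/n → log|μ₃|` — literally the last three conjuncts of the tree's named
fact `Zudilin2002.theorem1_rates`, now unconditional. (The decay conjuncts for `ℓₙ, ℓ̃ₙ` remain cited.) -/
theorem growth_rates :
    ∃ μ₃ : ℝ, charPoly μ₃ = 0 ∧ μ₃ ∈ Ioo (-236831752214 / 10 ^ 8 : ℝ) (-236831752213 / 10 ^ 8)
      ∧ Tendsto (fun n : ℕ => Real.log |(q n : ℝ)| / n) atTop (𝓝 (Real.log |μ₃|))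
      ∧ Tendsto (fun n : ℕ => Real.log |(p n : ℝ)| / n) atTop (𝓝 (Real.log |μ₃|))
      ∧ Tendsto (fun n : ℕ => Real.log |(ptilde n : ℝ)| / n) atTop (𝓝 (Real.log |μ₃|)) := by
  obtain ⟨μ, hμ, hroot⟩ := charPoly_roots.2
  have hle : μ ≤ -796 := by linarith [hμ.2]
  exact ⟨μ, hroot, hμ, tendsto_log_abs_q_div hroot hle, tendsto_log_abs_p_div hroot hle,
    tendsto_log_abs_ptilde_div hroot hle⟩

end Zudilin2002Growth

end Summit.KontsevichZagierPeriods.Zeta5Search
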